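import Mathlib
import HarnessLib
import Literature.NumberTheory.Irrationality.Zudilin2014.FirstTaleScaling
import Summits.KontsevichZagierPeriods.Zeta5Search.Denom.TwoTaleP15Levels
import Summits.KontsevichZagierPeriods.Zeta5Search.Denom.TwoTaleP15Bridge
import Summits.KontsevichZagierPeriods.Zeta5Search.TwoTaleP15Growth
import Summits.KontsevichZagierPeriods.Zeta5Search.TwoTaleP15FirstTaleCellsA
import Summits.KontsevichZagierPeriods.Zeta5Search.TwoTaleP15FirstTaleCellsB
import Summits.KontsevichZagierPeriods.Zeta5Search.TwoTaleP15FirstTaleCellsC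
import Summits.KontsevichZagierPeriods.Zeta5Search.TwoTaleP15SecondTaleCellsA
import Summits.KontsevichZagierPeriods.Zeta5Search.TwoTaleP15SecondTaleCellsB
import Summits.KontsevichZagierPeriods.Zeta5Search.TwoTaleP15SecondTaleBCellsA
import Summits.KontsevichZagierPeriods.Zeta5Search.TwoTaleP15SecondTaleBCellsB

/-!
# The two-tale point P15: `Inclusion` from the two-tale coincidence

HONEST FRAMING: systematic search; no irrationality claim unless certified.

Cell pub-zeta5, T3 service (P1 g9) [Zudilin2014ZetaTwo, Prop. 1, Lemmas 7–8, Remark 5].  This file assembles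
* the 15 first-tale interval theorems `ivl_0, ivl_1_left, ivl_2 … ivl_8` (level 1) and `ivl_10 … ivl_13, ivl_16 … ivl_18`
  (level 2) for `q_n = qP15 n` and `D₁₅ₙD₁₆ₙ p_n = pP15num n` (Lemma 7 at P15, unconditional),
* the 5 second-tale interval theorems `qhat_ivl_9/14/15/19/1_right` for `q̂_n` (Lemma 8 for `A_k`, unconditional) and
  `phat_ivl_9/14/15/19/1_right` for `D₁₅ₙD₁₆ₙ p_n` GIVEN `p_n = −p̂_n` (Lemma 8 for `B_k`),
* fam-denom's glue `Denom.TwoTaleP15Levels.inclusion_of_levels` (the 20 intervals `Denom.TwoTaleP15Saving.ivl` →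
  `Φ̃ₙ = savingProduct n`) and bridge `Denom.TwoTaleP15Bridge` (the explicit forms `Denom.TwoTaleP15Forms.formQ/formP`
  ARE `Zudilin2014.formQ/formP` at P15; its two hypotheses — the polar decomposition of `R` at the integers `m ≥ −11n`
  and `a₂* = 11n+1` — are discharged here by `FirstTaleScaling.R_eq_polyP_add_polar_full` and `a2star_eq`),
into **`inclusion_of_bmiss`**: the two-tale coincidence (bmiss)@P15 `q_n = −q̂_n ∧ p_n = −p̂_n` (all `n ≥ 1`; an INPUT —
certificate-verified outside the kernel by fam-tele, NOT a tree theorem) implies fam-denom's input node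
`Denom.TwoTaleP15Forms.Inclusion` (`Φ̃ₙ ∣ D₁₆ₙD₁₅ₙ q_n` and `Φ̃ₙ⁻¹D₁₆ₙD₁₅ₙ p_n ∈ ℤ`).  Also by name:
`qP15_eq_formQ`, `pP15num_eq_formP` (the two spellings of the forms agree, unconditional), `level1_dvd`, `level2_dvd`,
`savingProduct_dvd_qP15`, `savingProduct_dvd_pP15num`; and the NODE ALIGNMENT with fam-measure's `TwoTaleP15Growth`:
`qhatP15_eq_qhat` (my `q̂_n = formQTZ â b̂` IS fam-measure's `qhat n`, unconditional), so the `q`-half of (bmiss)@P15 is exactly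
fam-measure's node `WhippleP15` (`bmissQ_of_whipple`) and **`inclusion_of_whipple : WhippleP15 → (∀ n ≥ 1, p_n = −p̂_n) → Inclusion`**.
-/

noncomputable section

namespace Summit.KontsevichZagierPeriods.Zeta5Search.TwoTaleP15

open Finset Polynomial
open Literature.NumberTheory.Irrationality.Zudilin2014
open Literature.NumberTheory.DiophantineApproximation.RhinViola (classPrimes)
open Denom.TwoTaleP15Saving (ivl primeCut savingProduct)

/-! ### The two spellings of P15 agree -/

/-- `aP15 = pA` (P1 g9's and fam-denom's spellings of `a = (13n+1, 11n+1, 9n+1, 15n+1)`). -/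
theorem aP15_eq_pA (n : ℕ) : aP15 n = Denom.TwoTaleP15Bridge.pA n := rfl

/-- `bP15 = pB`. -/
theorem bP15_eq_pB (n : ℕ) : bP15 n = Denom.TwoTaleP15Bridge.pB n := rfl

/-- The polar decomposition of `R` at the integers `m ≥ −11n` (no pole there): hypothesis `hP` of
`Denom.TwoTaleP15Bridge.formP_eq`, from `R_eq_polyP_add_polar_full`. -/
theorem polar_P15 {n : ℕ} (hn : 1 ≤ n) (m : ℤ) (hm : -(11 * (n : ℤ)) ≤ m) :
    (polyP (Denom.TwoTaleP15Bridge.pA n) (Denom.TwoTaleP15Bridge.pB n)).eval (m : ℚ) =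
      R (Denom.TwoTaleP15Bridge.pA n) (Denom.TwoTaleP15Bridge.pB n) m -
        ∑ k ∈ Ico (Denom.TwoTaleP15Bridge.pA n 3) (Denom.TwoTaleP15Bridge.pB n 3),
          coefC (Denom.TwoTaleP15Bridge.pA n) (Denom.TwoTaleP15Bridge.pB n) k / ((m : ℚ) + k) := by
  rw [← aP15_eq_pA, ← bP15_eq_pB]
  have h := R_eq_polyP_add_polar_full (admissible hn) (t := (m : ℚ)) (fun k hk => by
    simp only [mem_Ico, aP15_three, bP15_three] at hk
    have : (0 : ℚ) < (m : ℚ) + k := by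
      have : (0 : ℤ) < m + k := by omega
      exact_mod_cast this
    exact this.ne')
  rw [h]; ring

/-- **`p_n` agrees** (unconditional): `Zudilin2014.formP (aP15 n) (bP15 n) = Denom.TwoTaleP15Forms.formP n`. -/
theorem formP_eq_formP {n : ℕ} (hn : 1 ≤ n) : formP (aP15 n) (bP15 n) = Denom.TwoTaleP15Forms.formP n :=
  Denom.TwoTaleP15Bridge.formP_eq hn (polar_P15 hn) (a2star_eq n)

/-- **`q_n` agrees**: `qP15 n = Denom.TwoTaleP15Forms.formQ n` (`n ≥ 1`). -/
theorem qP15_eq_formQ {n : ℕ} (hn : 1 ≤ n) : qP15 n = Denom.TwoTaleP15Forms.formQ n := by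
  have h1 := qP15_cast hn
  have h2 : formQ (aP15 n) (bP15 n) = (Denom.TwoTaleP15Forms.formQ n : ℚ) := Denom.TwoTaleP15Bridge.formQ_eq hn
  exact_mod_cast h1.trans h2

/-- **`D₁₆ₙD₁₅ₙ p_n` agrees**: `D₁₆ₙD₁₅ₙ · Denom.TwoTaleP15Forms.formP n = pP15num n` (`n ≥ 1`). -/
theorem pP15num_eq_formP {n : ℕ} (hn : 1 ≤ n) :
    ((Denom.TwoTaleP15Forms.lcmNormaliser n : ℕ) : ℚ) * Denom.TwoTaleP15Forms.formP n = (pP15num n : ℚ) := by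
  rw [pP15num_cast hn, formP_eq_formP hn, Denom.TwoTaleP15Forms.lcmNormaliser]; push_cast; ring

/-- Under the `q`-half of (bmiss)@P15, `q_n = −q̂_n` in `ℤ`. -/
theorem qP15_eq_neg_qhat {n : ℕ} (hn : 1 ≤ n) (hb : formQ (aP15 n) (bP15 n) = -formQT (aT n) (bT n)) :
    qP15 n = -qhatP15 n := by
  have h := qP15_cast hn
  rw [hb, ← qhatP15_cast hn] at h
  exact_mod_cast h

/-! ### The 20 intervals, level by level -/

/-- **Level 1** (`ivl 0 … ivl 8`): `p ∣ q_n` and `p ∣ D₁₅ₙD₁₆ₙ p_n` — first tale on `ivl 0, 2, …, 8` and on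
`[1/11, 3/13) ⊂ ivl 1`; second tale (given (bmiss)@P15 at `n`) on `[3/13, 4/17) ⊂ ivl 1`. -/
theorem level1_dvd {n : ℕ} (hn : 1 ≤ n)
    (hb : formQ (aP15 n) (bP15 n) = -formQT (aT n) (bT n) ∧ formP (aP15 n) (bP15 n) = -formPT (aT n) (bT n))
    {i : ℕ} (hi : i < 9) {p : ℕ} (hp : p.Prime) (hp2 : 26 * n < p ^ 2)
    (hu : (ivl i).1 ≤ Int.fract ((n : ℝ) / p)) (hv : Int.fract ((n : ℝ) / p) < (ivl i).2) :
    (p : ℤ) ∣ qP15 n ∧ (p : ℤ) ∣ pP15num n := by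
  interval_cases i
  · simpa using ivl_0 hn hp hp2 (by simpa [ivl] using hu) (by simpa [ivl] using hv)
  · have hu' : (1 / 11 : ℝ) ≤ Int.fract ((n : ℝ) / p) := by simpa [ivl] using hu
    have hv' : Int.fract ((n : ℝ) / p) < 4 / 17 := by simpa [ivl] using hv
    rcases lt_or_ge (Int.fract ((n : ℝ) / p)) (3 / 13) with h | h
    · simpa using ivl_1_left hn hp hp2 hu' h
    · refine ⟨?_, by simpa using phat_ivl_1_right hn hp hp2 hb.2 h hv'⟩
      rw [qP15_eq_neg_qhat hn hb.1, dvd_neg]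
      simpa using qhat_ivl_1_right hn hp h hv'
  · simpa using ivl_2 hn hp hp2 (by simpa [ivl] using hu) (by simpa [ivl] using hv)
  · simpa using ivl_3 hn hp hp2 (by simpa [ivl] using hu) (by simpa [ivl] using hv)
  · simpa using ivl_4 hn hp hp2 (by simpa [ivl] using hu) (by simpa [ivl] using hv)
  · simpa using ivl_5 hn hp hp2 (by simpa [ivl] using hu) (by simpa [ivl] using hv)
  · simpa using ivl_6 hn hp hp2 (by simpa [ivl] using hu) (by simpa [ivl] using hv)
  · simpa using ivl_7 hn hp hp2 (by simpa [ivl] using hu) (by simpa [ivl] using hv)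
  · simpa using ivl_8 hn hp hp2 (by simpa [ivl] using hu) (by simpa [ivl] using hv)

/-- **Level 2** (`ivl 9 … ivl 19`): `p² ∣ q_n` and `p² ∣ D₁₅ₙD₁₆ₙ p_n` — first tale on `ivl 10–13, 16–18`, second tale
(given (bmiss)@P15 at `n`) on `ivl 9, 14, 15, 19`. -/
theorem level2_dvd {n : ℕ} (hn : 1 ≤ n)
    (hb : formQ (aP15 n) (bP15 n) = -formQT (aT n) (bT n) ∧ formP (aP15 n) (bP15 n) = -formPT (aT n) (bT n))
    {i : ℕ} (hi : 9 ≤ i) (hi' : i < 20) {p : ℕ} (hp : p.Prime) (hp2 : 26 * n < p ^ 2)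
    (hu : (ivl i).1 ≤ Int.fract ((n : ℝ) / p)) (hv : Int.fract ((n : ℝ) / p) < (ivl i).2) :
    (p : ℤ) ^ 2 ∣ qP15 n ∧ (p : ℤ) ^ 2 ∣ pP15num n := by
  interval_cases i
  · have hu' : (1 / 11 : ℝ) ≤ Int.fract ((n : ℝ) / p) := by simpa [ivl] using hu
    have hv' : Int.fract ((n : ℝ) / p) < 2 / 17 := by simpa [ivl] using hv
    refine ⟨?_, phat_ivl_9 hn hp hp2 hb.2 hu' hv'⟩
    rw [qP15_eq_neg_qhat hn hb.1, dvd_neg]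
    exact qhat_ivl_9 hn hp hu' hv'
  · exact ivl_10 hn hp hp2 (by simpa [ivl] using hu) (by simpa [ivl] using hv)
  · exact ivl_11 hn hp hp2 (by simpa [ivl] using hu) (by simpa [ivl] using hv)
  · exact ivl_12 hn hp hp2 (by simpa [ivl] using hu) (by simpa [ivl] using hv)
  · exact ivl_13 hn hp hp2 (by simpa [ivl] using hu) (by simpa [ivl] using hv)
  · have hu' : (5 / 11 : ℝ) ≤ Int.fract ((n : ℝ) / p) := by simpa [ivl] using hu
    have hv' : Int.fract ((n : ℝ) / p) < 7 / 15 := by simpa [ivl] using hv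
    refine ⟨?_, phat_ivl_14 hn hp hp2 hb.2 hu' hv'⟩
    rw [qP15_eq_neg_qhat hn hb.1, dvd_neg]
    exact qhat_ivl_14 hn hp hu' hv'
  · have hu' : (6 / 11 : ℝ) ≤ Int.fract ((n : ℝ) / p) := by simpa [ivl] using hu
    have hv' : Int.fract ((n : ℝ) / p) < 9 / 16 := by simpa [ivl] using hv
    refine ⟨?_, phat_ivl_15 hn hp hp2 hb.2 hu' hv'⟩
    rw [qP15_eq_neg_qhat hn hb.1, dvd_neg]
    exact qhat_ivl_15 hn hp hu' hv'
  · exact ivl_16 hn hp hp2 (by simpa [ivl] using hu) (by simpa [ivl] using hv)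
  · exact ivl_17 hn hp hp2 (by simpa [ivl] using hu) (by simpa [ivl] using hv)
  · exact ivl_18 hn hp hp2 (by simpa [ivl] using hu) (by simpa [ivl] using hv)
  · have hu' : (10 / 11 : ℝ) ≤ Int.fract ((n : ℝ) / p) := by simpa [ivl] using hu
    have hv' : Int.fract ((n : ℝ) / p) < 14 / 15 := by simpa [ivl] using hv
    refine ⟨?_, phat_ivl_19 hn hp hp2 hb.2 hu' hv'⟩
    rw [qP15_eq_neg_qhat hn hb.1, dvd_neg]
    exact qhat_ivl_19 hn hp hu' hv'

/-! ### `Φ̃ₙ ∣ q_n`, `Φ̃ₙ ∣ D₁₅ₙD₁₆ₙ p_n`, and `Inclusion` -/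

/-- **`Φ̃ₙ ∣ q_n`** given (bmiss)@P15 at `n ≥ 1`. -/
theorem savingProduct_dvd_qP15 {n : ℕ} (hn : 1 ≤ n)
    (hb : formQ (aP15 n) (bP15 n) = -formQT (aT n) (bT n) ∧ formP (aP15 n) (bP15 n) = -formPT (aT n) (bT n)) :
    (savingProduct n : ℤ) ∣ qP15 n :=
  Denom.TwoTaleP15Levels.savingProduct_dvd_of_unpacked
    (fun _ hi _ hp hp2 hu hv => (level1_dvd hn hb hi hp hp2 hu hv).1)
    (fun _ hi hi' _ hp hp2 hu hv => (level2_dvd hn hb hi hi' hp hp2 hu hv).1)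

/-- **`Φ̃ₙ ∣ D₁₅ₙD₁₆ₙ p_n`** given (bmiss)@P15 at `n ≥ 1`. -/
theorem savingProduct_dvd_pP15num {n : ℕ} (hn : 1 ≤ n)
    (hb : formQ (aP15 n) (bP15 n) = -formQT (aT n) (bT n) ∧ formP (aP15 n) (bP15 n) = -formPT (aT n) (bT n)) :
    (savingProduct n : ℤ) ∣ pP15num n :=
  Denom.TwoTaleP15Levels.savingProduct_dvd_of_unpacked
    (fun _ hi _ hp hp2 hu hv => (level1_dvd hn hb hi hp hp2 hu hv).2)
    (fun _ hi hi' _ hp hp2 hu hv => (level2_dvd hn hb hi hi' hp hp2 hu hv).2)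

/-- **fam-denom's input `Inclusion` from the two-tale coincidence (bmiss)@P15** (`q_n = −q̂_n ∧ p_n = −p̂_n` for all
`n ≥ 1` — an INPUT hypothesis, certificate-verified outside the kernel): `Φ̃ₙ ∣ D₁₆ₙD₁₅ₙ q_n` and
`Φ̃ₙ⁻¹ D₁₆ₙD₁₅ₙ p_n ∈ ℤ` for every `n ≥ 1`. -/
theorem inclusion_of_bmiss
    (hbmiss : ∀ n : ℕ, 1 ≤ n →
      formQ (aP15 n) (bP15 n) = -formQT (aT n) (bT n) ∧ formP (aP15 n) (bP15 n) = -formPT (aT n) (bT n)) :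
    Denom.TwoTaleP15Forms.Inclusion := by
  intro n hn
  refine ⟨?_, ⟨pP15num n / (savingProduct n : ℤ), ?_⟩⟩
  · obtain ⟨B, hB⟩ := savingProduct_dvd_qP15 hn (hbmiss n hn)
    refine ⟨((Denom.TwoTaleP15Forms.lcmNormaliser n : ℕ) : ℤ) * B, ?_⟩
    rw [← qP15_eq_formQ hn, hB]; ring
  · rw [pP15num_eq_formP hn, Int.cast_div (savingProduct_dvd_pP15num hn (hbmiss n hn))
      (by exact_mod_cast (Denom.TwoTaleP15Saving.savingProduct_pos n).ne'), Int.cast_natCast,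
      mul_div_cancel₀ _ (by exact_mod_cast (Denom.TwoTaleP15Saving.savingProduct_pos n).ne')]

/-! ### Node alignment: the `q`-half of (bmiss)@P15 is fam-measure's `WhippleP15` -/

/-- Termwise: my `coefATZ â b̂ k` (Zudilin's `A_k` at the partner, signed product of four binomials) is fam-measure's
`TwoTaleP15Growth.taleTwoA n k` on `15n+1 ≤ k < 24n+2` (the sign `(−1)^{2k−6n−2} = 1`; both vanish for `k ≤ 16n`). -/
theorem coefATZ_eq_taleTwoA (n k : ℕ) (hk : 15 * n + 1 ≤ k) (hk' : k < 24 * n + 2) :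
    coefATZ (aT n) (bT n) (k : ℤ) = (TwoTaleP15Growth.taleTwoA n k : ℤ) := by
  unfold coefATZ TwoTaleP15Growth.taleTwoA
  simp only [aT_zero, aT_one, aT_two, aT_three, bT_zero, bT_one, bT_two, bT_three]
  by_cases h16 : 16 * n + 1 ≤ k
  · rw [if_neg (by omega)]
    have e0 : (2 * (k : ℤ) - (15 * n + 2)).toNat = 2 * k - (15 * n + 2) := by omega
    have e0' : (32 * (n : ℤ) + 2 - (15 * n + 2)).toNat = 17 * n := by omega
    have e1 : ((k : ℤ) - (6 * n + 1)).toNat = k - (6 * n + 1) := by omega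
    have e1' : (11 * (n : ℤ) + 1 - (6 * n + 1)).toNat = 5 * n := by omega
    have e2 : (24 * (n : ℤ) + 2 - (13 * n + 1) - 1).toNat = 11 * n := by omega
    have e2' : ((k : ℤ) - (13 * n + 1)).toNat = k - (13 * n + 1) := by omega
    have e3 : (26 * (n : ℤ) + 2 - (15 * n + 1) - 1).toNat = 11 * n := by omega
    have e3' : ((k : ℤ) - (15 * n + 1)).toNat = k - (15 * n + 1) := by omega
    rw [e0, e0', e1, e1', e2, e2', e3, e3']
    have hs : Even (17 * n + 5 * n + (k - (13 * n + 1)) + (k - (15 * n + 1))) := ⟨k - 3 * n - 1, by omega⟩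
    rw [hs.neg_one_pow]
    push_cast
    ring
  · rw [if_pos (by omega)]
    rw [Nat.choose_eq_zero_of_lt (by omega : 2 * k - (15 * n + 2) < 17 * n)]
    simp

/-- **`q̂_n` agrees**: `qhatP15 n = TwoTaleP15Growth.qhat n` (unconditional; fam-measure's range `[15n+1, 26n+2)` exceeds
mine `[â₃*, b̂₂*) = [15n+1, 24n+2)` by terms that vanish). -/
theorem qhatP15_eq_qhat (n : ℕ) : qhatP15 n = (TwoTaleP15Growth.qhat n : ℤ) := by
  unfold qhatP15 formQTZ TwoTaleP15Growth.qhat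
  obtain ⟨hA3, hB2⟩ := range_eq n
  rw [hA3, hB2]
  have hsign : ((-1 : ℤ)) ^ (bT n 2 + bT n 3).natAbs = 1 := by
    rw [bT_two, bT_three]
    have : (24 * (n : ℤ) + 2 + (26 * n + 2)).natAbs = 2 * (25 * n + 2) := by omega
    rw [this, pow_mul]; simp
  rw [hsign, one_mul, show (15 * (n : ℤ) + 1) = ((15 * n + 1 : ℕ) : ℤ) by push_cast; ring,
    show (24 * (n : ℤ) + 2) = ((24 * n + 2 : ℕ) : ℤ) by push_cast; ring,
    Denom.TwoTaleP15Bridge.Ico_natCast_eq_map, sum_map, Nat.cast_sum]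
  have hsub : Ico (15 * n + 1) (24 * n + 2) ⊆ Ico (15 * n + 1) (26 * n + 2) := Ico_subset_Ico le_rfl (by omega)
  rw [← sum_subset hsub fun k hk hk' => by
    rw [mem_Ico] at hk hk'
    have hk2 : 24 * n + 2 ≤ k := by omega
    unfold TwoTaleP15Growth.taleTwoA
    rw [Nat.choose_eq_zero_of_lt (by omega : 11 * n < k - (13 * n + 1))]
    simp]
  refine sum_congr rfl fun k hk => ?_
  rw [mem_Ico] at hk
  rw [Nat.castEmbedding_apply, coefATZ_eq_taleTwoA n k hk.1 hk.2]

/-- **The `q`-half of (bmiss)@P15 from fam-measure's `WhippleP15`** (`formQ n = −qhat n`): `q(a,b) = −q̂(â,b̂)` at P15. -/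
theorem bmissQ_of_whipple (hW : TwoTaleP15Growth.WhippleP15) {n : ℕ} (hn : 1 ≤ n) :
    formQ (aP15 n) (bP15 n) = -formQT (aT n) (bT n) := by
  have h := hW n hn
  rw [← qP15_eq_formQ hn, ← qhatP15_eq_qhat] at h
  rw [← qP15_cast hn, ← qhatP15_cast hn, h]
  push_cast
  ring

/-- **`Inclusion` from `WhippleP15` and the `p`-half of the two-tale coincidence** (`p_n = −p̂_n` for all `n ≥ 1`, an
INPUT — certificate-verified outside the kernel; given `WhippleP15` and the two line representations it would also follow
from `ζ(2) ∉ ℚ`, not formalised). -/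
theorem inclusion_of_whipple (hW : TwoTaleP15Growth.WhippleP15)
    (hP : ∀ n : ℕ, 1 ≤ n → formP (aP15 n) (bP15 n) = -formPT (aT n) (bT n)) :
    Denom.TwoTaleP15Forms.Inclusion :=
  inclusion_of_bmiss fun n hn => ⟨bmissQ_of_whipple hW hn, hP n hn⟩

end Summit.KontsevichZagierPeriods.Zeta5Search.TwoTaleP15

end
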